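import Summits.HubbardSuperconductivity.HubbardSuperconductivity.Theorems.AnisotropyChordInsertionEntropyJastrowCanonical

/-!
# Route `AnisotropyChord` / H0 rotor rung: UNCONDITIONAL ODLRO of every ℓ¹-Jastrow (Rokhsar–Kivelson) hard-core state
# at every filling on every finite abelian group (the finite-range Jastrow class of theory seat memo ROTOR-THEORY-7 §94,
# now as a theorem about concrete states, via the canonical one-state chain of `…JastrowCanonical`)

* `condensateDensity_jastrowSector_ge_group` : the canonical screening ⇒ ODLRO link on any finite additive commutative
  group `G` with an even difference kernel (translations act transitively ⇒ uniform density);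
* `abs_spectatorField_sub_le` : `|Φ_τ(y) − Φ_τ(x)| ≤ 2 ‖W‖_{ℓ¹}`;
* `exists_particleCount_eq` : every `N ≤ |G|` is attained;
* **`condensateDensity_jastrowSector_ge_of_l1`** : for EVERY even kernel `W : G → ℝ`, every `N ≤ |G|`:
  `n₀/|G| ≥ (N/|G|)(1 − N/|G|) · exp(−Σ_v |W v|)` for the `N`-particle state `ψ ∝ [|σ|=N] exp(−¼ Σ_{u,v} n_u n_v W(u−v))`
  — no hypothesis at all (finite-range / summable Jastrow states always condense, in any dimension, uniformly in the
  volume when `‖W‖_{ℓ¹}` is volume-independent; the tree's abstract criterion `condensateDensity_ge_of_onebody` is the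
  two-state analogue).
-/

set_option linter.dupNamespace false

noncomputable section

open Finset

namespace Summit.HubbardSuperconductivity.HubbardSuperconductivity.Theorems.AnisotropyChord.InsertionEntropy

section JastrowL1

variable {G : Type} [AddCommGroup G] [Fintype G] [DecidableEq G]

/-- **Canonical screening ⇒ ODLRO on any finite abelian group** (translation-invariant even kernel `W`): a bound `K`
on the canonical mean spectator-potential shift for all `x ≠ y` gives `n₀/|G| ≥ (N/|G|)(1 − N/|G|) e^{−K/2}` for the
`N`-particle Jastrow state.  (`condensateDensity_jastrowSector_ge` is the case `G = (ℤ/L)²`.) [folklore] -/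
theorem condensateDensity_jastrowSector_ge_group (W : G → ℝ) (hW : ∀ v, W (-v) = W v)
    (N : ℕ) (hZ : 0 < jastrowSectorWeight (fun u v : G => W (u - v)) N) (K : ℝ)
    (hK : ∀ x y : G, x ≠ y →
      ∑ τ, teleLaw (jastrowSectorAmp (fun u v => W (u - v)) N) x y τ
          * (spectatorField (fun u v => W (u - v)) τ y - spectatorField (fun u v => W (u - v)) τ x) ≤ K) :
    ((N : ℝ) / Fintype.card G) * (1 - (N : ℝ) / Fintype.card G) * Real.exp (-K / 2)
      ≤ condensateDensity (jastrowSectorAmp (fun u v => W (u - v)) N) := by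
  have : Nonempty G := ⟨0⟩
  set w : G → G → ℝ := fun u v => W (u - v) with hwdef
  set a := jastrowSectorAmp w N with hadef
  have hw : ∀ u v, w u v = w v u := fun u v => by
    show W (u - v) = W (v - u)
    rw [← hW (u - v), neg_sub]
  have hinv : ∀ v : G, ∀ σ, a (σ ∘ (Equiv.addRight v)) = a σ := by
    intro v σ
    exact jastrowSectorAmp_comp_equiv w N (Equiv.addRight v) (fun u u' => by
      show W (u + v - (u' + v)) = W (u - u')
      congr 1; abel) σ
  have hdens : ∀ x : G, siteDensity a x = siteDensity a 0 := by
    intro x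
    have h := siteDensity_comp_equiv (Equiv.addRight x) a (hinv x) 0
    have h0 : (Equiv.addRight x) (0 : G) = x := by simp
    rw [h0] at h
    exact h
  have hsym : ∀ x y, pairMass a x y = pairMass a y x :=
    pairMass_symm_of_siteDensity a (siteDensity a 0) hdens
  have hsect : ∀ σ, a σ ≠ 0 → ((univ.filter fun z => σ z = 0).card : ℝ) = (N : ℝ) := by
    intro σ hσ
    exact_mod_cast particleCount_eq_of_jastrowSectorAmp_ne_zero w N σ hσ
  have hKL : ∀ x y : G, x ≠ y → klDiv (teleLaw a x y) (teleLaw a y x) ≤ K := by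
    intro x y hxy
    rw [hadef, klDiv_teleLaw_jastrowSector w hw N hZ x y (by simp [hwdef]) (hsym y x)]
    exact hK x y hxy
  exact condensateDensity_ge_of_teleEntropy' a (N : ℝ) (siteDensity a 0) K (jastrowSectorAmp_nonneg w N)
    (sum_jastrowSectorAmp_sq w N hZ) hsect hdens
    (fun x y τ _ h => teleLaw_jastrowSector_pos_symm w N hZ x y τ h) hKL

omit [DecidableEq G] in
/-- The spectator potential of a difference kernel is bounded by `‖W‖_{ℓ¹}`. [folklore] -/
theorem abs_spectatorField_le (W : G → ℝ) (τ : G → Fin 2) (x : G) :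
    |spectatorField (fun u v => W (u - v)) τ x| ≤ ∑ v, |W v| := by
  unfold spectatorField
  calc |∑ z, occ τ z * W (z - x)| ≤ ∑ z, |occ τ z * W (z - x)| := Finset.abs_sum_le_sum_abs _ _
    _ ≤ ∑ z, |W (z - x)| := by
        refine Finset.sum_le_sum fun z _ => ?_
        rw [abs_mul]
        have hocc : |occ τ z| ≤ 1 := by unfold occ; split_ifs <;> simp
        exact mul_le_of_le_one_left (abs_nonneg _) hocc
    _ = ∑ v, |W v| := Fintype.sum_equiv (Equiv.subRight x) _ _ (fun _ => rfl)

omit [DecidableEq G] in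
/-- `Φ_τ(y) − Φ_τ(x) ≤ 2‖W‖_{ℓ¹}`. [folklore] -/
theorem spectatorField_sub_le (W : G → ℝ) (τ : G → Fin 2) (x y : G) :
    spectatorField (fun u v => W (u - v)) τ y - spectatorField (fun u v => W (u - v)) τ x ≤ 2 * ∑ v, |W v| := by
  have h1 := abs_spectatorField_le W τ y
  have h2 := abs_spectatorField_le W τ x
  rw [abs_le] at h1 h2
  linarith [h1.2, h2.1]

omit [AddCommGroup G] in
/-- Every particle number `N ≤ |G|` is attained by some configuration. [folklore] -/
theorem exists_particleCount_eq (N : ℕ) (hN : N ≤ Fintype.card G) : ∃ σ : G → Fin 2, particleCount σ = N := by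
  have hN' : N ≤ (univ : Finset G).card := by rw [Finset.card_univ]; exact hN
  obtain ⟨s, -, hs⟩ := Finset.exists_subset_card_eq hN'
  refine ⟨fun z => if z ∈ s then 0 else 1, ?_⟩
  unfold particleCount
  rw [← hs]
  congr 1
  ext z
  simp only [Finset.mem_filter, Finset.mem_univ, true_and]
  by_cases hz : z ∈ s <;> simp [hz]

/-- **UNCONDITIONAL ODLRO OF ℓ¹-JASTROW STATES.**  For every finite abelian group `G`, every even kernel `W : G → ℝ` and
every `N ≤ |G|`, the `N`-particle hard-core Jastrow / Rokhsar–Kivelson state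
`ψ_{W,N}(σ) ∝ [|σ| = N] exp(−¼ Σ_{u,v} n_u n_v W(u − v))` has condensate density
`n₀/|G| ≥ (N/|G|) (1 − N/|G|) · exp(−Σ_v |W v|)`.
With `‖W‖_{ℓ¹}` bounded uniformly in the volume (finite-range or summable Jastrow families on `(ℤ/L)^d`, any `d`) this is
Bose–Einstein condensation at every filling, uniformly in `L` — the finite-range Jastrow class of theory seat memo
ROTOR-THEORY-7 §94 as a theorem about the states themselves (two-defect screening is trivial for summable kernels:
`|Φ_τ(y) − Φ_τ(x)| ≤ 2‖W‖_{ℓ¹}`). [folklore] -/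
theorem condensateDensity_jastrowSector_ge_of_l1 (W : G → ℝ) (hW : ∀ v, W (-v) = W v) (N : ℕ)
    (hN : N ≤ Fintype.card G) :
    ((N : ℝ) / Fintype.card G) * (1 - (N : ℝ) / Fintype.card G) * Real.exp (-(∑ v, |W v|))
      ≤ condensateDensity (jastrowSectorAmp (fun u v => W (u - v)) N) := by
  have hZ : 0 < jastrowSectorWeight (fun u v : G => W (u - v)) N :=
    jastrowSectorWeight_pos _ N (exists_particleCount_eq N hN)
  have h := condensateDensity_jastrowSector_ge_group W hW N hZ (2 * ∑ v, |W v|) (fun x y _ => by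
    set a := jastrowSectorAmp (fun u v : G => W (u - v)) N
    calc ∑ τ, teleLaw a x y τ
            * (spectatorField (fun u v => W (u - v)) τ y - spectatorField (fun u v => W (u - v)) τ x)
        ≤ ∑ τ, teleLaw a x y τ * (2 * ∑ v, |W v|) :=
          Finset.sum_le_sum fun τ _ =>
            mul_le_mul_of_nonneg_left (spectatorField_sub_le W τ x y) (teleLaw_nonneg a x y τ)
      _ = (∑ τ, teleLaw a x y τ) * (2 * ∑ v, |W v|) := by rw [Finset.sum_mul]
      _ ≤ 1 * (2 * ∑ v, |W v|) := by
          refine mul_le_mul_of_nonneg_right ?_ (by positivity)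
          rcases eq_or_lt_of_le (pairMass_nonneg a x y) with h0 | hpos
          · -- empty support: the teleportation law vanishes identically
            have : ∑ τ, teleLaw a x y τ = 0 := by
              refine Finset.sum_eq_zero fun τ _ => ?_
              unfold teleLaw
              split_ifs
              · rw [← h0, div_zero]
              · rfl
            rw [this]; exact zero_le_one
          · exact (sum_teleLaw a x y hpos).le
      _ = 2 * ∑ v, |W v| := one_mul _)
  have e : -(2 * ∑ v, |W v|) / 2 = -(∑ v, |W v|) := by ring
  rw [e] at h
  exact h

end JastrowL1

end Summit.HubbardSuperconductivity.HubbardSuperconductivity.Theorems.AnisotropyChord.InsertionEntropy
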